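import Summits.HubbardSuperconductivity.HubbardSuperconductivity.Theorems.BalabanIRBirComplexStableXYRHolonomyTheta
import Summits.HubbardSuperconductivity.HubbardSuperconductivity.Theorems.BalabanIRBirComplexStableXYRStubHolonomyStrainConst
import Summits.HubbardSuperconductivity.HubbardSuperconductivity.Theorems.BalabanIRBirComplexStableXYRStubPathCfgConst
import Summits.HubbardSuperconductivity.HubbardSuperconductivity.Theorems.BalabanIRBirComplexStableXYRStubConstCochainPythagoras
import HarnessLib

/-!
# Crux `BirComplexStableXYR` (stmt-HubbardSuperconductivity-14845), line `fat-gaussian-defect-calculus`, chapter 2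
# §2.1: the stiffness matrix is EXPLICIT — glue between seat 1's sector layer and lead c8's wave 8

Support file (prover seat 1, route BalabanIR; item G2).

Seat 1's `stub_holonomyQuadraticForm` / `stub_fluxThetaPositive` / `stub_fixedVorticityFlux` produce the stiffness matrix
`S` of the holonomy sectors ABSTRACTLY (`𝒬(σ(seam h)) = hᵀSh`, coercive, positive definite; flux series with Berry phase
positive; shifted theta series at fixed vorticity).  Lead c8's wave 8 computes the vortex-free strain EXACTLY: by
translation invariance constants are `𝒬`-orthogonal to gradients (E1 `FSUnfolding.stub_constCochainPythagoras`), so the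
strain of `seam h` is the constant twist `(2πh_i/N_i)_i` (E3 `FSUnfolding.stub_holonomyStrainConst`), whose window
configuration is `w ↦ 2π(h₀w₁/L + h₁w₂/L + h₂w₃/M)` (E2 `FSUnfolding.stub_pathCfg_const`).  This file glues the two:

* **`stub_stiffnessExplicit`** (registered stub): for ANY strain map with the two properties of `stub_fsRepresentation`
  there is a symmetric `S` with `𝒬(σ(seam h)) = Σ S_{ij}h_ih_j` on `ℤ³` (this pins `S`, `vfs_symm_eq_of_intQuad_eq`)
  whose REAL quadratic form is the window form of the linear configuration:
  `Σ_{ij} S_{ij} x_i x_j = |Λ| · Q(w ↦ 2π(x₀w₁/L + x₁w₂/L + x₂w₃/M))` for all `x ∈ ℝ³`.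
  Hence every statement of seat 1's layer about `S` (positive definiteness, tilted-theta positivity and uniform lower
  bounds, fixed-vorticity shifts) is a statement about the explicit `3 × 3` window form, and lead c8's factorisation
  under (R) (E5/E6) applies to `S` verbatim.

No definitions; sorry-free. [folklore]
-/

noncomputable section

namespace Summit.HubbardSuperconductivity.HubbardSuperconductivity.Theorems

set_option linter.dupNamespace false -- summit = problem name (single-conjunct summit), D-0017

open scoped BigOperators ComplexConjugate
open Complex Summit.HubbardSuperconductivity.BirComplexStableXYNegative
open Literature.Probability.LatticeModels Literature.MathematicalPhysics.QuantumFieldTheory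

section StiffnessExplicit

variable {r : ℕ} {L M : ℕ} [NeZero L] [NeZero M]

/-- **Registered stub `stub_stiffnessExplicit` (prover seat 1 on stmt-HubbardSuperconductivity-14845; chapter 2 §2.1,
glue with lead c8's E1–E3): the stiffness matrix of the holonomy sectors is the window form of the linear
configurations.**  Hypotheses as in `stub_holonomyQuadraticForm` plus (N) (used by E1/E3).  Conclusion: a symmetric `S`
with `𝒬(σ(seam h)) = Σ S_{ij}h_ih_j` on `ℤ³` and `Σ S_{ij}x_ix_j = |Λ|·Q(w ↦ 2π(x₀w₁/L + x₁w₂/L + x₂w₃/M))` on `ℝ³`.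
[folklore] -/
theorem stub_stiffnessExplicit : ∀ (r : ℕ) (c : Table r) (c₀ : ℝ), 2 ≤ r → 0 < c₀ → c.sum (fun _ a => a) = 0 → (∀ φ : W r → ℝ, c₀ * ∑ w, ∑ w', (1 - Real.cos (φ w - φ w')) ≤ (genF c φ).re) → ∀ (L M : ℕ) [NeZero L] [NeZero M] (P : (Λ L M → Fin 3 → ℝ) → Λ L M → W r → ℝ), (∀ (ω : Λ L M → Fin 3 → ℝ) (s : Λ L M) (w : W r), P ω s w = (TorusChart.piProdZMod 2 L M).lineSum ω 0 (w.1 : ℕ) s + (TorusChart.piProdZMod 2 L M).lineSum ω 1 (w.2.1 : ℕ) (s + (w.1 : ℕ) • (TorusChart.piProdZMod 2 L M).gen 0) + (TorusChart.piProdZMod 2 L M).lineSum ω 2 (w.2.2 : ℕ) (s + (w.1 : ℕ) • (TorusChart.piProdZMod 2 L M).gen 0 + (w.2.1 : ℕ) • (TorusChart.piProdZMod 2 L M).gen 1)) → ∀ (Q : (W r → ℝ) → ℝ), (∀ u : W r → ℝ, Q u = (-c.sum (fun n a => a * (((∑ w, (n w : ℝ) * u w) ^ 2 : ℝ) : ℂ))).re)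 → ∀ (σ : {a : Λ L M → Fin 3 → ℤ // ∀ (y : Λ L M) (μ : Fin 3), (∀ ν : Fin 3, μ < ν → (TorusChart.piProdZMod 2 L M).cval ν y = 0) → (TorusChart.piProdZMod 2 L M).cval μ y + 1 < (TorusChart.piProdZMod 2 L M).period μ → a y μ = 0} → (Λ L M → Fin 3 → ℝ)), (∀ a, ∃ ψ : Λ L M → ℝ, σ a = fun x i => 2 * Real.pi * (a.1 x i : ℝ) - (TorusChart.piProdZMod 2 L M).d₀ ψ x i) → (∀ a (u : Λ L M → ℝ), ∑ s : Λ L M, Q (P (fun x i => (TorusChart.piProdZMod 2 L M).d₀ u x i - σ a x i) s) = ∑ s : Λ L M, Q (P ((TorusChart.piProdZMod 2 L M).d₀ u) s) + ∑ s : Λ L M, Q (P (σ a) s)) → ∃ S : Fin 3 → Fin 3 → ℝ, (∀ i j, S i j = S j i) ∧ (∀ h : Fin 3 → ℤ, ∑ s : Λ L M, Q (P (σ ⟨(TorusChart.piProdZMod 2 L M).seam h, fun y μ _ hμ => (TorusChart.piProdZMod 2 L M).seam_of_lt h y μ hμ⟩) s) = ∑ i : Fin 3, ∑ j : Fin 3,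 S i j * (h i : ℝ) * (h j : ℝ)) ∧ (∀ x : Fin 3 → ℝ, ∑ i : Fin 3, ∑ j : Fin 3, S i j * x i * x j = (Fintype.card (Λ L M) : ℝ) * Q (fun w : W r => 2 * Real.pi * (x 0 * ((w.1 : ℕ) : ℝ) / L + x 1 * ((w.2.1 : ℕ) : ℝ) / L + x 2 * ((w.2.2 : ℕ) : ℝ) / M))) := by
  intro r c c₀ hr hc₀ hA hC L M _ _ P hP Q hQ σ hcls hpy
  obtain ⟨B, hBsymm, hBdiag⟩ := FSUnfolding.stub_thinFormPolar r c L M P hP Q hQ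
  have hper0 : (TorusChart.piProdZMod 2 L M).period 0 = L := TorusChart.piProdZMod_period_castSucc 2 L M 0
  have hper1 : (TorusChart.piProdZMod 2 L M).period 1 = L := TorusChart.piProdZMod_period_castSucc 2 L M 1
  have hper2 : (TorusChart.piProdZMod 2 L M).period 2 = M := TorusChart.piProdZMod_period_last 2 L M
  -- E1: constants are `𝒬`-orthogonal to gradients; E3: the unit strains are the constant twists `2π e_i/N_i`
  have hE1 := FSUnfolding.stub_constCochainPythagoras r c L M P hP Q hQ
  have hconst : ∀ k : Fin 3 → ℤ, σ ⟨(TorusChart.piProdZMod 2 L M).seam k, hth_seam_comb k⟩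
      = fun _ i => 2 * Real.pi * (k i : ℝ) / ((TorusChart.piProdZMod 2 L M).period i : ℝ) :=
    fun k => FSUnfolding.stub_holonomyStrainConst r c c₀ hr hc₀ hA hC L M P hP Q hQ hE1 k
      ((TorusChart.piProdZMod 2 L M).seam k) ((TorusChart.piProdZMod 2 L M).d₁_seam k)
      ((TorusChart.piProdZMod 2 L M).wind_seam k) _ (hcls _) (hpy _)
  -- the stiffness matrix and its integer quadratic form (as in `stub_holonomyQuadraticForm`)
  have hsum : ∀ h : Fin 3 → ℤ, σ ⟨(TorusChart.piProdZMod 2 L M).seam h, hth_seam_comb h⟩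
      = ∑ i : Fin 3, (h i : ℝ) • σ ⟨(TorusChart.piProdZMod 2 L M).seam (Pi.single i (1 : ℤ)),
          hth_seam_comb (Pi.single i (1 : ℤ))⟩ :=
    fun h => hth_strain_seam_eq_sum c hr hc₀ hA hC P hP Q hQ σ hcls hpy h
  refine ⟨fun i j => B (σ ⟨(TorusChart.piProdZMod 2 L M).seam (Pi.single i (1 : ℤ)), hth_seam_comb (Pi.single i (1 : ℤ))⟩)
      (σ ⟨(TorusChart.piProdZMod 2 L M).seam (Pi.single j (1 : ℤ)), hth_seam_comb (Pi.single j (1 : ℤ))⟩),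
    fun i j => hBsymm _ _, fun h => ?_, fun x => ?_⟩
  · rw [← hBdiag, hsum h]
    exact hth_bilin_expand B _ _
  · -- the real quadratic form is `𝒬` of the constant cochain `κ_x = (2π x_i/N_i)_i`
    have hexp := hth_bilin_expand B
      (fun i => σ ⟨(TorusChart.piProdZMod 2 L M).seam (Pi.single i (1 : ℤ)), hth_seam_comb (Pi.single i (1 : ℤ))⟩) x
    rw [← hexp, hBdiag]
    have hκ : ∑ i : Fin 3, x i • σ ⟨(TorusChart.piProdZMod 2 L M).seam (Pi.single i (1 : ℤ)), hth_seam_comb (Pi.single i (1 : ℤ))⟩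
        = fun (_ : Λ L M) (μ : Fin 3) => 2 * Real.pi * x μ / ((TorusChart.piProdZMod 2 L M).period μ : ℝ) := by
      funext y μ
      simp only [hconst, Finset.sum_apply, Pi.smul_apply, smul_eq_mul, Pi.single_apply, Int.cast_ite, Int.cast_one,
        Int.cast_zero, mul_ite, mul_one, mul_zero, Fin.sum_univ_three]
      fin_cases μ <;> simp <;> ring
    rw [hκ]
    -- E2: the window configuration of a constant cochain, and the sum over corners
    have hPc := FSUnfolding.stub_pathCfg_const r L M P hP (fun μ => 2 * Real.pi * x μ / ((TorusChart.piProdZMod 2 L M).period μ : ℝ))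
    have hcfg : ∀ s : Λ L M, P (fun (_ : Λ L M) (μ : Fin 3) => 2 * Real.pi * x μ / ((TorusChart.piProdZMod 2 L M).period μ : ℝ)) s
        = fun w : W r => 2 * Real.pi * (x 0 * ((w.1 : ℕ) : ℝ) / L + x 1 * ((w.2.1 : ℕ) : ℝ) / L + x 2 * ((w.2.2 : ℕ) : ℝ) / M) := by
      intro s
      funext w
      rw [hPc, hper0, hper1, hper2]
      ring
    simp only [hcfg, Finset.sum_const, Finset.card_univ, nsmul_eq_mul]

end StiffnessExplicit

end Summit.HubbardSuperconductivity.HubbardSuperconductivity.Theorems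

end
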